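import Literature.AlgebraicGeometry.Resolution.ProjectiveModelsDomination
import HarnessLib

/-!
# Projective models from birational modifications

Topic: `Literature/AlgebraicGeometry/Resolution`. A constructor for the projective models of
`ProjectiveModels.lean` (`ProjModel k K`: integral projective `k`-schemes with function field
`K`, Zariski–Samuel II Ch. VI §17, Piltant 2013 §2) complementing `ProjModel.ofChart`,
`ProjModel.ofClosure` and `ProjModel.join`: **a projective birational modification of a projective
model is a projective model dominating it.** Precisely, for `M : ProjModel k K`, an integral
`X''`, a `k`-projective `ρ : X'' → M` and an open `U ⊆ M`, non-empty, over which `ρ` is an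
isomorphism (e.g. a composition of blowing ups along non-zero centres, `IsBlowup.isBirational'`,
`IsRegularCentreBlowupSeq.exists_extension`), `ProjModel.ofModification` is the model
`(X'', ρ ≫ π_M)` whose `K`-point is the lift of `gen_M` through `ρ⁻¹(U) ≅ U`, and
`ProjModel.ofModificationHom` is `ρ` as a morphism of models. This is how the blowing ups of
Zariski–Piltant patching (Piltant 2013, Prop. 5.1: "replacing `X₂` by `Z₁`", "replacing `X'₁` by
`X''₁`") re-enter the category of projective models. All PROVED; `ofModification_X`,
`ofModificationHom_f` are `rfl`.

## References

* O. Zariski, P. Samuel, *Commutative Algebra* II, Ch. VI §17. [ZariskiSamuel1960]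
* O. Piltant, RACSAM 107 (2013), §2 and Prop. 5.1. [Piltant2013]
-/

noncomputable section

open CategoryTheory AlgebraicGeometry TopologicalSpace IsLocalRing

namespace Literature.AlgebraicGeometry.Resolution

universe u

namespace ProjModel

variable {k K : Type u} [Field k] [Field K] [Algebra k K]

section Modification

variable (M : ProjModel k K) {X'' : Scheme.{u}} (ρ : X'' ⟶ M.X)
  (U : M.X.Opens) (hU : (U : Set M.X).Nonempty)

/-- The generic point of `M` lies in every non-empty open. [folklore] -/
theorem genericPoint_mem {U : M.X.Opens} (hU : (U : Set M.X).Nonempty) : genericPoint M.X ∈ U := by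
  obtain ⟨x, hx⟩ := hU
  exact ((genericPoint_spec M.X).mem_open_set_iff U.isOpen).2 ⟨x, Set.mem_univ _, hx⟩

/-- The `K`-point `gen_M` factors through every non-empty open `U`. [folklore] -/
theorem range_gen_subset {U : M.X.Opens} (hU : (U : Set M.X).Nonempty) :
    Set.range M.gen ⊆ Set.range U.ι := by
  rw [Scheme.Opens.range_ι, range_gen]
  exact Set.singleton_subset_iff.mpr (M.genericPoint_mem hU)

/-- The lift `Spec K → U` of `gen_M` into a non-empty open `U`. [folklore] -/
def genLift {U : M.X.Opens} (hU : (U : Set M.X).Nonempty) : Spec (CommRingCat.of K) ⟶ U :=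
  IsOpenImmersion.lift U.ι M.gen (M.range_gen_subset hU)

/-- `genLift ≫ (U ↪ M) = gen_M`. [folklore] -/
@[reassoc (attr := simp)]
theorem genLift_ι {U : M.X.Opens} (hU : (U : Set M.X).Nonempty) : M.genLift hU ≫ U.ι = M.gen :=
  IsOpenImmersion.lift_fac _ _ _

/-- `𝒪_{U,ξ} → K` is an isomorphism for the lifted `K`-point. [folklore] -/
instance isIso_stalkClosedPointTo_genLift {U : M.X.Opens} (hU : (U : Set M.X).Nonempty) :
    IsIso (Scheme.stalkClosedPointTo (M.genLift hU)) := by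
  have h : IsIso (Scheme.stalkClosedPointTo (M.genLift hU ≫ U.ι)) := by
    rw [genLift_ι]; infer_instance
  rw [Scheme.stalkClosedPointTo_comp] at h
  have e : Scheme.stalkClosedPointTo (M.genLift hU) = inv (U.ι.stalkMap _) ≫
      (U.ι.stalkMap ((M.genLift hU) (closedPoint K)) ≫ Scheme.stalkClosedPointTo (M.genLift hU)) := by
    rw [IsIso.inv_hom_id_assoc]
  rw [e]
  exact IsIso.comp_isIso' inferInstance h

variable [IsIso (ρ ∣_ U)]

/-- The open immersion `ρ⁻¹(U) ≅ U`-inverse followed by `ρ⁻¹(U) ↪ X''`. [folklore] -/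
def invOver : (U : Scheme.{u}) ⟶ X'' :=
  inv (ρ ∣_ U) ≫ (ρ ⁻¹ᵁ U).ι

/-- `invOver ≫ ρ = U ↪ M`. [folklore] -/
@[reassoc (attr := simp)]
theorem invOver_ρ : invOver M ρ U ≫ ρ = U.ι := by
  rw [invOver, Category.assoc, ← morphismRestrict_ι, IsIso.inv_hom_id_assoc]

/-- `invOver` is an open immersion. [folklore] -/
instance isOpenImmersion_invOver : IsOpenImmersion (invOver M ρ U) := by
  unfold invOver; infer_instance

/-- The `K`-point of the modification: `gen_M` lifted through `ρ⁻¹(U) ≅ U`. [folklore] -/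
def genOfModification : Spec (CommRingCat.of K) ⟶ X'' :=
  M.genLift hU ≫ invOver M ρ U

/-- The `K`-point of the modification lies over `gen_M`. [folklore] -/
@[reassoc (attr := simp)]
theorem genOfModification_ρ : genOfModification M ρ U hU ≫ ρ = M.gen := by
  rw [genOfModification, Category.assoc, invOver_ρ, genLift_ι]

variable [IsIntegral X'']

/-- The `K`-point of the modification hits the generic point of `X''`. [folklore] -/
theorem genOfModification_closedPoint :
    genOfModification M ρ U hU (closedPoint K) = genericPoint X'' := by
  haveI : Nonempty (U : Scheme.{u}) := ⟨M.genLift hU (closedPoint K)⟩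
  haveI : IsIntegral (U : Scheme.{u}) := isIntegral_of_isOpenImmersion U.ι
  have h1 : M.genLift hU (closedPoint K) = genericPoint (U : Scheme.{u}) :=
    eq_genericPoint_of_comp_ι U (M.genLift hU) (M.genLift_ι hU)
  rw [genOfModification, Scheme.Hom.comp_apply, h1]
  exact genericPoint_eq_of_isOpenImmersion (invOver M ρ U)

omit [IsIntegral X''] in
/-- `𝒪_{X'',ξ} → K` is an isomorphism for the `K`-point of the modification. [folklore] -/
instance isIso_stalkClosedPointTo_genOfModification :
    IsIso (Scheme.stalkClosedPointTo (genOfModification M ρ U hU)) := by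
  have h1 : ∀ x, IsIso ((invOver M ρ U).stalkMap x) := fun x => inferInstance
  rw [genOfModification, Scheme.stalkClosedPointTo_comp]
  exact IsIso.comp_isIso' (h1 _) (isIso_stalkClosedPointTo_genLift M hU)

variable (hproj : Motives.IsProjectiveOver (Over.mk (ρ ≫ M.π) : Motives.SchemeOver k))

/-- **The modification model.** For a projective model `M` of `K/k`, an integral `X''` and a
`k`-projective `ρ : X'' → M` which is an isomorphism over a non-empty open `U ⊆ M`, the
projective model `(X'', ρ ≫ π_M)` of `K/k` with `K`-point the lift of `gen_M` (Piltant 2013,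
proof of Prop. 5.1: the blowing ups `Z₁ → X₂`, `X''₁ → X'₁` are again projective models of `K`).
[cite: Piltant2013, Prop. 5.1 (proof, Steps 2 and 4)] -/
def ofModification : ProjModel k K where
  X := X''
  π := ρ ≫ M.π
  gen := genOfModification M ρ U hU
  gen_π := by rw [genOfModification_ρ_assoc, M.gen_π]
  isIntegral := inferInstance
  isProjectiveOver := hproj
  genericPt_eq := genOfModification_closedPoint M ρ U hU
  isIso_stalkClosedPointTo := inferInstance

/-- The underlying scheme of the modification model is `X''`. [folklore] -/
@[simp] theorem ofModification_X : (ofModification M ρ U hU hproj).X = X'' := rfl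

/-- The structure morphism of the modification model. [folklore] -/
@[simp] theorem ofModification_π : (ofModification M ρ U hU hproj).π = ρ ≫ M.π := rfl

/-- The `K`-point of the modification model. [folklore] -/
@[simp] theorem ofModification_gen :
    (ofModification M ρ U hU hproj).gen = genOfModification M ρ U hU := rfl

/-- **The modification dominates the model**: `ρ` as a morphism of projective models.
[cite: Piltant2013, Prop. 5.1 (proof, Step 2)] -/
def ofModificationHom : (ofModification M ρ U hU hproj).Hom M where
  f := ρ
  f_π := rfl
  gen_f := genOfModification_ρ M ρ U hU

/-- The underlying morphism of `ofModificationHom` is `ρ`. [folklore] -/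
@[simp] theorem ofModificationHom_f : (ofModificationHom M ρ U hU hproj).f = ρ := rfl

end Modification

/-! ## From `IsBirational` -/

/-- A birational morphism to a projective model is an isomorphism over some non-empty open.
[folklore] -/
theorem exists_nonempty_isIso_morphismRestrict (M : ProjModel k K) {X'' : Scheme.{u}}
    {ρ : X'' ⟶ M.X} (hρ : IsBirational ρ) :
    ∃ U : M.X.Opens, (U : Set M.X).Nonempty ∧ IsIso (ρ ∣_ U) := by
  obtain ⟨U, hUd, -, hiso⟩ := hρ
  exact ⟨U, hUd.nonempty, hiso⟩

/-- **A projective birational modification of a projective model is dominated-by data**: for an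
integral `X''` and a `k`-projective birational `ρ : X'' → M` there is a projective model `N` of
`K/k` with underlying scheme `X''` and a morphism of models `N → M` with underlying morphism `ρ`.
[cite: Piltant2013, Prop. 5.1 (proof, Step 2)] -/
theorem exists_projModel_of_isBirational (M : ProjModel k K) {X'' : Scheme.{u}} [IsIntegral X'']
    (ρ : X'' ⟶ M.X) (hρ : IsBirational ρ)
    (hproj : Motives.IsProjectiveOver (Over.mk (ρ ≫ M.π) : Motives.SchemeOver k)) :
    ∃ (N : ProjModel k K) (φ : N.Hom M) (e : N.X = X''), φ.f = eqToHom e ≫ ρ := by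
  obtain ⟨U, hU, hiso⟩ := M.exists_nonempty_isIso_morphismRestrict hρ
  haveI := hiso
  exact ⟨ofModification M ρ U hU hproj, ofModificationHom M ρ U hU hproj, rfl, by simp⟩

end ProjModel

end Literature.AlgebraicGeometry.Resolution

end
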